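import Mathlib
import Literature.Topology.FourManifolds.OneParameterTransversality
import HarnessLib

/-!
# Local models of the moves of indefinite fibrations: suspended families and their critical sets

Topic `Literature/Topology/FourManifolds`.  Near a critical point of rank one, a map from a
4-manifold to a surface — and any deformation of it — can be written
`(t, x, y, z) ↦ (t, f(t, x, y, z))` (Lekili 2009, §3, p. 11: *"If the rank is `1`, then around
`p` we can find local coordinates such that `F` is of the form `(t,x,y,z) → (t, f(t,x,y,z))` by
the inverse function theorem"*), and all the rank-one local models used in the constructions of
broken Lefschetz fibrations are SUSPENDED one-variable families
`(t, x, y, z) ↦ (t, g(t, x) + y² - z²)`: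
the indefinite fold (`g = x²`), the indefinite cusp (`g = x³ + t x`), and Lekili's moves
(Lekili 2009, §3): **birth** `g = x³ + 3(t² - s) x` (Move 1, *"For `s<0`, this is a genuine fibre
bundle … For `s>0`, the critical point set of `F_s` is the circle `{x²+t²=s, y=z=0}`"*),
**merging** `g = x³ + 3(s - t²) x` (Move 2) and **flipping** `g = x⁴ - x² s + x t` (Move 3);
these are the always-realizable mono-germ moves of Baykur–Saeki 2017, §3.1 (birth, flip, and
their inverses), by which Thm. 6.1 there turns a generic map into a broken Lefschetz fibration.
This file computes, once and for all, the differential and the critical set of a suspended family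
and reads off the critical sets of the three moves.  Everything is PROVED; no named fact.

## Main definitions and results

* `suspendedMap g : ℝ⁴ → ℝ²`, `(t, x, y, z) ↦ (t, g(t, x) + y² - z²)` for `g : ℝ × ℝ → ℝ`;
  `suspendedDeriv g' x`, `hasFDerivAt_suspendedMap`, `contDiff_suspendedMap`.
* `surjective_suspendedDeriv_iff`: **the differential is onto iff `(∂ₓg, y, z) ≠ 0`** — the
  critical set of a suspended family is `{∂ₓ g(t, x) = 0, y = z = 0}`
  (`surjective_fderiv_suspendedMap_iff`).
* `birthMap s`, `mergeMap s`, `flipMap s` (Lekili's Moves 1–3) and their critical sets: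
  `surjective_fderiv_birthMap_iff` (critical set `{t² + x² = s, y = z = 0}`: empty for `s < 0`,
  `surjective_fderiv_birthMap_of_neg`; the origin for `s = 0`; a circle for `s > 0`),
  `surjective_fderiv_mergeMap_iff` (critical set `{x² = t² - s, y = z = 0}`),
  `surjective_fderiv_flipMap_iff` (critical set the graph `t = 2 s x - 4 x³`, `y = z = 0`, a
  connected smooth curve for every `s`).

The fold and cusp instances are `IndefiniteFoldModel.lean` and `IndefiniteCuspModel.lean`.

## References

* Y. Lekili, *Wrinkled fibrations on near-symplectic manifolds*, Geom. Topol. 13 (2009)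
  277–318 (arXiv:0712.2202), §3, Moves 1–3. [Lekili2009]
* R. İ. Baykur, O. Saeki, *Simplifying indefinite fibrations on 4-manifolds*, arXiv:1705.11169,
  §2.1, §3.1. [BaykurSaeki2017]
-/

noncomputable section

open scoped ContDiff
open Set Function

namespace Literature.Topology.FourManifolds

/-- Local notation: `𝔼 n` is the model Euclidean space `EuclideanSpace ℝ (Fin n)`. -/
local notation "𝔼 " n:arg => EuclideanSpace ℝ (Fin n)

/-! ### Suspended families `(t, x, y, z) ↦ (t, g(t, x) + y² - z²)` -/

/-- **The suspended family** of `g : ℝ × ℝ → ℝ`: the map `ℝ⁴ → ℝ²`,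
`(t, x, y, z) ↦ (t, g(t, x) + y² - z²)` (coordinates `x 0 = t`, `x 1 = x`, `x 2 = y`,
`x 3 = z`) — the common shape of the rank-one local models of maps from 4-manifolds to surfaces
(Lekili 2009, §3). [cite: Lekili2009, §3] -/
def suspendedMap (g : ℝ × ℝ → ℝ) (x : 𝔼 4) : 𝔼 2 :=
  (x 0) • EuclideanSpace.single (0 : Fin 2) (1 : ℝ) +
    (g (x 0, x 1) + x 2 ^ 2 - x 3 ^ 2) • EuclideanSpace.single (1 : Fin 2) (1 : ℝ)

/-- First component of a suspended family: `t`. [folklore] -/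
@[simp] theorem suspendedMap_apply_zero (g : ℝ × ℝ → ℝ) (x : 𝔼 4) :
    suspendedMap g x 0 = x 0 := by
  simp [suspendedMap]

/-- Second component of a suspended family: `g(t, x) + y² - z²`. [folklore] -/
@[simp] theorem suspendedMap_apply_one (g : ℝ × ℝ → ℝ) (x : 𝔼 4) :
    suspendedMap g x 1 = g (x 0, x 1) + x 2 ^ 2 - x 3 ^ 2 := by
  simp [suspendedMap]

/-- A suspended family is as smooth as `g`. [folklore] -/
theorem contDiff_suspendedMap {g : ℝ × ℝ → ℝ} {n : WithTop ℕ∞} (hg : ContDiff ℝ n g) :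
    ContDiff ℝ n (suspendedMap g) := by
  have hc : ∀ i : Fin 4, ContDiff ℝ n fun x : 𝔼 4 => x i := fun i =>
    (EuclideanSpace.proj i : 𝔼 4 →L[ℝ] ℝ).contDiff
  unfold suspendedMap
  exact ((hc 0).smul contDiff_const).add
    ((((hg.comp ((hc 0).prodMk (hc 1))).add ((hc 2).pow 2)).sub ((hc 3).pow 2)).smul
      contDiff_const)

/-- **The derivative of a suspended family** at `x`, given the derivative `g'` of `g` at
`(x₀, x₁)`: `v ↦ (v₀, g'(v₀, v₁) + 2x₂ v₂ - 2x₃ v₃)`. [folklore] -/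
def suspendedDeriv (g' : ℝ × ℝ →L[ℝ] ℝ) (x : 𝔼 4) : 𝔼 4 →L[ℝ] 𝔼 2 :=
  (EuclideanSpace.proj (0 : Fin 4) : 𝔼 4 →L[ℝ] ℝ).smulRight
      (EuclideanSpace.single (0 : Fin 2) (1 : ℝ)) +
    (g'.comp ((EuclideanSpace.proj (0 : Fin 4) : 𝔼 4 →L[ℝ] ℝ).prod
          (EuclideanSpace.proj (1 : Fin 4) : 𝔼 4 →L[ℝ] ℝ)) +
        (2 * x 2) • (EuclideanSpace.proj (2 : Fin 4) : 𝔼 4 →L[ℝ] ℝ) -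
        (2 * x 3) • (EuclideanSpace.proj (3 : Fin 4) : 𝔼 4 →L[ℝ] ℝ)).smulRight
      (EuclideanSpace.single (1 : Fin 2) (1 : ℝ))

/-- First component of the derivative: `(dF_x v)₀ = v₀`. [folklore] -/
@[simp] theorem suspendedDeriv_apply_zero (g' : ℝ × ℝ →L[ℝ] ℝ) (x v : 𝔼 4) :
    suspendedDeriv g' x v 0 = v 0 := by
  simp [suspendedDeriv, ContinuousLinearMap.smulRight_apply]

/-- Second component of the derivative: `(dF_x v)₁ = g'(v₀, v₁) + 2x₂ v₂ - 2x₃ v₃`.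
[folklore] -/
@[simp] theorem suspendedDeriv_apply_one (g' : ℝ × ℝ →L[ℝ] ℝ) (x v : 𝔼 4) :
    suspendedDeriv g' x v 1 = g' (v 0, v 1) + 2 * x 2 * v 2 - 2 * x 3 * v 3 := by
  simp [suspendedDeriv, ContinuousLinearMap.smulRight_apply]

/-- **Chain rule for a suspended family**: if `g` has derivative `g'` at `(x₀, x₁)` then
`suspendedMap g` has derivative `suspendedDeriv g' x` at `x`. [folklore] -/
theorem hasFDerivAt_suspendedMap {g : ℝ × ℝ → ℝ} {g' : ℝ × ℝ →L[ℝ] ℝ} {x : 𝔼 4}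
    (hg : HasFDerivAt g g' (x 0, x 1)) :
    HasFDerivAt (suspendedMap g) (suspendedDeriv g' x) x := by
  have hc : ∀ i : Fin 4, HasFDerivAt (fun x : 𝔼 4 => x i)
      (EuclideanSpace.proj i : 𝔼 4 →L[ℝ] ℝ) x := fun i =>
    (EuclideanSpace.proj i : 𝔼 4 →L[ℝ] ℝ).hasFDerivAt
  have hP : HasFDerivAt (fun x : 𝔼 4 => (x 0, x 1))
      ((EuclideanSpace.proj (0 : Fin 4) : 𝔼 4 →L[ℝ] ℝ).prod
        (EuclideanSpace.proj (1 : Fin 4) : 𝔼 4 →L[ℝ] ℝ)) x := (hc 0).prodMk (hc 1)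
  have hq : HasFDerivAt (fun x : 𝔼 4 => g (x 0, x 1) + x 2 ^ 2 - x 3 ^ 2)
      (g'.comp ((EuclideanSpace.proj (0 : Fin 4) : 𝔼 4 →L[ℝ] ℝ).prod
          (EuclideanSpace.proj (1 : Fin 4) : 𝔼 4 →L[ℝ] ℝ)) +
        (2 * x 2) • (EuclideanSpace.proj (2 : Fin 4) : 𝔼 4 →L[ℝ] ℝ) -
        (2 * x 3) • (EuclideanSpace.proj (3 : Fin 4) : 𝔼 4 →L[ℝ] ℝ)) x := by
    refine (((hg.comp x hP).add ((hc 2).pow 2)).sub ((hc 3).pow 2)).congr_fderiv ?_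
    ext v
    simp
  exact ((hc 0).smul_const _).add (hq.smul_const _)

/-- `fderiv` form of `hasFDerivAt_suspendedMap`. [folklore] -/
theorem fderiv_suspendedMap {g : ℝ × ℝ → ℝ} {g' : ℝ × ℝ →L[ℝ] ℝ} {x : 𝔼 4}
    (hg : HasFDerivAt g g' (x 0, x 1)) :
    fderiv ℝ (suspendedMap g) x = suspendedDeriv g' x :=
  (hasFDerivAt_suspendedMap hg).fderiv

/-- **The differential of a suspended family is onto iff `(∂ₓ g, x₂, x₃) ≠ 0`**, where
`∂ₓ g = g'(0, 1)` is the derivative of `g` in its second variable: the rows of `dF_x` are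
`(1, 0, 0, 0)` and `(∂ₜ g, ∂ₓ g, 2x₂, -2x₃)`.  Hence the critical set of `(t, g(t,x) + y² - z²)`
is `{∂ₓ g(t, x) = 0, y = z = 0}` (Lekili 2009, §3: *"the critical point set of `F_s` is the
circle `{x²+t²=s, y=z=0}`"* for the birth family). [folklore] -/
theorem surjective_suspendedDeriv_iff (g' : ℝ × ℝ →L[ℝ] ℝ) (x : 𝔼 4) :
    Surjective (suspendedDeriv g' x) ↔ ¬ (g' (0, 1) = 0 ∧ x 2 = 0 ∧ x 3 = 0) := by
  constructor
  · rintro hs ⟨h1, h2, h3⟩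
    obtain ⟨v, hv⟩ := hs (EuclideanSpace.single (1 : Fin 2) (1 : ℝ))
    have hv0 : v 0 = 0 := by simpa using congrArg (fun w : 𝔼 2 => w 0) hv
    have hv1 : g' (v 0, v 1) + 2 * x 2 * v 2 - 2 * x 3 * v 3 = 1 := by
      simpa using congrArg (fun w : 𝔼 2 => w 1) hv
    rw [OneParamTransversality.apply_prod_eq, h1, h2, h3, hv0] at hv1
    simp at hv1
  · intro hx w
    -- `w = dF_x v` for `v = (w₀, c, 0, 0)`, `(w₀, 0, c, 0)` or `(w₀, 0, 0, c)`, using a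
    -- coordinate whose coefficient in the second row of `dF_x` is `≠ 0`
    have key : ∀ v : 𝔼 4, v 0 = w 0 →
        g' (v 0, v 1) + 2 * x 2 * v 2 - 2 * x 3 * v 3 = w 1 → suspendedDeriv g' x v = w := by
      intro v hv0 hv1
      ext i
      fin_cases i
      · simpa using hv0
      · simpa using hv1
    by_cases h2 : x 2 = 0
    · by_cases h3 : x 3 = 0
      · have h1 : g' (0, 1) ≠ 0 := fun h1 => hx ⟨h1, h2, h3⟩
        obtain ⟨c, hc⟩ : ∃ c : ℝ, g' (0, 1) * c = w 1 - w 0 * g' (1, 0) :=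
          ⟨_, mul_div_cancel₀ _ h1⟩
        refine ⟨WithLp.toLp 2 ![w 0, c, 0, 0], key _ (by simp) ?_⟩
        simp only [Matrix.cons_val_zero, Matrix.cons_val_one,
          Matrix.cons_val]
        rw [OneParamTransversality.apply_prod_eq, h2, h3]
        linear_combination hc
      · obtain ⟨c, hc⟩ : ∃ c : ℝ, (2 * x 3) * c = w 0 * g' (1, 0) - w 1 :=
          ⟨_, mul_div_cancel₀ _ (mul_ne_zero two_ne_zero h3)⟩
        refine ⟨WithLp.toLp 2 ![w 0, 0, 0, c], key _ (by simp) ?_⟩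
        simp only [Matrix.cons_val_zero, Matrix.cons_val_one,
          Matrix.cons_val]
        rw [OneParamTransversality.apply_prod_eq, h2]
        linear_combination -hc
    · obtain ⟨c, hc⟩ : ∃ c : ℝ, (2 * x 2) * c = w 1 - w 0 * g' (1, 0) :=
        ⟨_, mul_div_cancel₀ _ (mul_ne_zero two_ne_zero h2)⟩
      refine ⟨WithLp.toLp 2 ![w 0, 0, c, 0], key _ (by simp) ?_⟩
      simp only [Matrix.cons_val_zero, Matrix.cons_val_one,
        Matrix.cons_val]
      rw [OneParamTransversality.apply_prod_eq]
      linear_combination hc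

/-- **Critical set of a suspended family** (`fderiv` form): if `g` has derivative `g'` at
`(x₀, x₁)`, then `dF_x` is onto iff `(g'(0,1), x₂, x₃) ≠ 0`. [folklore] -/
theorem surjective_fderiv_suspendedMap_iff {g : ℝ × ℝ → ℝ} {g' : ℝ × ℝ →L[ℝ] ℝ} {x : 𝔼 4}
    (hg : HasFDerivAt g g' (x 0, x 1)) :
    Surjective (fderiv ℝ (suspendedMap g) x) ↔ ¬ (g' (0, 1) = 0 ∧ x 2 = 0 ∧ x 3 = 0) := by
  rw [fderiv_suspendedMap hg, surjective_suspendedDeriv_iff]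

/-! ### Lekili's Move 1: birth `(t, x³ + 3(t² - s) x + y² - z²)` -/

/-- **The birth family** (Lekili 2009, §3, Move 1; Eliashberg–Mishachev's wrinkling map):
`F_s (t, x, y, z) = (t, x³ + 3(t² - s) x + y² - z²)`. [cite: Lekili2009, §3 Move 1] -/
def birthMap (s : ℝ) : 𝔼 4 → 𝔼 2 :=
  suspendedMap fun p => p.2 ^ 3 + 3 * (p.1 ^ 2 - s) * p.2

/-- The birth family is smooth. [folklore] -/
theorem contDiff_birthMap (s : ℝ) : ContDiff ℝ ∞ (birthMap s) :=
  contDiff_suspendedMap ((contDiff_snd.pow 3).add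
    ((contDiff_const.mul ((contDiff_fst.pow 2).sub contDiff_const)).mul contDiff_snd))

/-- **Critical set of the birth family**: `d(F_s)_x` is onto iff NOT (`t² + x² = s` and
`y = z = 0`) — *"For `s>0`, the critical point set of `F_s` is the circle `{x²+t²=s, y=z=0}`"*
(Lekili 2009, §3, Move 1); at `s = 0` it is the origin alone and for `s < 0` it is empty.
[cite: Lekili2009, §3 Move 1] -/
theorem surjective_fderiv_birthMap_iff (s : ℝ) (x : 𝔼 4) :
    Surjective (fderiv ℝ (birthMap s) x) ↔ ¬ (x 0 ^ 2 + x 1 ^ 2 = s ∧ x 2 = 0 ∧ x 3 = 0) := by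
  obtain ⟨g', hg, hval⟩ : ∃ g' : ℝ × ℝ →L[ℝ] ℝ,
      HasFDerivAt (fun p : ℝ × ℝ => p.2 ^ 3 + 3 * (p.1 ^ 2 - s) * p.2) g' (x 0, x 1) ∧
        g' (0, 1) = 3 * x 1 ^ 2 + 3 * (x 0 ^ 2 - s) :=
    ⟨_, (hasFDerivAt_snd.pow 3).add
      ((((hasFDerivAt_fst.pow 2).sub_const s).const_mul 3).mul hasFDerivAt_snd), by simp⟩
  rw [birthMap, surjective_fderiv_suspendedMap_iff hg, hval]
  refine not_congr (and_congr ⟨fun h => ?_, fun h => ?_⟩ Iff.rfl) <;> linarith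

/-- **Before the birth (`s < 0`) the family is a submersion**: no critical points at all
(*"For `s<0`, this is a genuine fibre bundle"*). [cite: Lekili2009, §3 Move 1] -/
theorem surjective_fderiv_birthMap_of_neg {s : ℝ} (hs : s < 0) (x : 𝔼 4) :
    Surjective (fderiv ℝ (birthMap s) x) := by
  rw [surjective_fderiv_birthMap_iff]
  rintro ⟨h, -, -⟩
  nlinarith [sq_nonneg (x 0), sq_nonneg (x 1)]

/-- **At the birth parameter `s = 0` the only critical point is the origin.** [folklore] -/
theorem surjective_fderiv_birthMap_zero_iff (x : 𝔼 4) :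
    Surjective (fderiv ℝ (birthMap 0) x) ↔ x ≠ 0 := by
  rw [surjective_fderiv_birthMap_iff]
  refine not_congr ⟨fun ⟨h, h2, h3⟩ => ?_, fun h => by subst h; simp⟩
  have h0 : x 0 = 0 := by nlinarith [sq_nonneg (x 0), sq_nonneg (x 1)]
  have h1 : x 1 = 0 := by nlinarith [sq_nonneg (x 0), sq_nonneg (x 1)]
  ext i
  fin_cases i
  · simpa using h0
  · simpa using h1
  · simpa using h2
  · simpa using h3

/-! ### Lekili's Move 2: merging `(t, x³ + 3(s - t²) x + y² - z²)` -/

/-- **The merging family** (Lekili 2009, §3, Move 2):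
`F_s (t, x, y, z) = (t, x³ + 3(s - t²) x + y² - z²)`. [cite: Lekili2009, §3 Move 2] -/
def mergeMap (s : ℝ) : 𝔼 4 → 𝔼 2 :=
  suspendedMap fun p => p.2 ^ 3 + 3 * (s - p.1 ^ 2) * p.2

/-- The merging family is smooth. [folklore] -/
theorem contDiff_mergeMap (s : ℝ) : ContDiff ℝ ∞ (mergeMap s) :=
  contDiff_suspendedMap ((contDiff_snd.pow 3).add
    ((contDiff_const.mul (contDiff_const.sub (contDiff_fst.pow 2))).mul contDiff_snd))

/-- **Critical set of the merging family**: `d(F_s)_x` is onto iff NOT (`x² = t² - s` and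
`y = z = 0`); for `s < 0` the critical set `{x² - t² = -s}` is a hyperbola with two branches
(two fold arcs), for `s > 0` the two branches of `{t² - x² = s}` (Lekili 2009, §3, Move 2).
[cite: Lekili2009, §3 Move 2] -/
theorem surjective_fderiv_mergeMap_iff (s : ℝ) (x : 𝔼 4) :
    Surjective (fderiv ℝ (mergeMap s) x) ↔ ¬ (x 1 ^ 2 = x 0 ^ 2 - s ∧ x 2 = 0 ∧ x 3 = 0) := by
  obtain ⟨g', hg, hval⟩ : ∃ g' : ℝ × ℝ →L[ℝ] ℝ,
      HasFDerivAt (fun p : ℝ × ℝ => p.2 ^ 3 + 3 * (s - p.1 ^ 2) * p.2) g' (x 0, x 1) ∧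
        g' (0, 1) = 3 * x 1 ^ 2 + 3 * (s - x 0 ^ 2) :=
    ⟨_, (hasFDerivAt_snd.pow 3).add
      ((((hasFDerivAt_fst.pow 2).const_sub s).const_mul 3).mul hasFDerivAt_snd), by simp⟩
  rw [mergeMap, surjective_fderiv_suspendedMap_iff hg, hval]
  refine not_congr (and_congr ⟨fun h => ?_, fun h => ?_⟩ Iff.rfl) <;> linarith

/-! ### Lekili's Move 3: flipping `(t, x⁴ - s x² + t x + y² - z²)` -/

/-- **The flipping family** (Lekili 2009, §3, Move 3, after Auroux):
`F_s (t, x, y, z) = (t, x⁴ - x² s + x t + y² - z²)`. [cite: Lekili2009, §3 Move 3] -/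
def flipMap (s : ℝ) : 𝔼 4 → 𝔼 2 :=
  suspendedMap fun p => p.2 ^ 4 - s * p.2 ^ 2 + p.1 * p.2

/-- The flipping family is smooth. [folklore] -/
theorem contDiff_flipMap (s : ℝ) : ContDiff ℝ ∞ (flipMap s) :=
  contDiff_suspendedMap (((contDiff_snd.pow 4).sub (contDiff_const.mul (contDiff_snd.pow 2))).add
    (contDiff_fst.mul contDiff_snd))

/-- **Critical set of the flipping family**: `d(F_s)_x` is onto iff NOT
(`t = 2 s x - 4 x³` and `y = z = 0`) — for every `s` the critical set is the graph of
`x ↦ t = 2 s x - 4 x³` over the `x`-axis, a single connected smooth curve (the flip does not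
change the critical SET; it creates two cusps on it for `s > 0`, Lekili 2009, §3, Move 3).
[cite: Lekili2009, §3 Move 3] -/
theorem surjective_fderiv_flipMap_iff (s : ℝ) (x : 𝔼 4) :
    Surjective (fderiv ℝ (flipMap s) x) ↔
      ¬ (x 0 = 2 * s * x 1 - 4 * x 1 ^ 3 ∧ x 2 = 0 ∧ x 3 = 0) := by
  obtain ⟨g', hg, hval⟩ : ∃ g' : ℝ × ℝ →L[ℝ] ℝ,
      HasFDerivAt (fun p : ℝ × ℝ => p.2 ^ 4 - s * p.2 ^ 2 + p.1 * p.2) g' (x 0, x 1) ∧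
        g' (0, 1) = 4 * x 1 ^ 3 - s * (2 * x 1) + x 0 :=
    ⟨_, ((hasFDerivAt_snd.pow 4).sub ((hasFDerivAt_snd.pow 2).const_mul s)).add
      (hasFDerivAt_fst.mul hasFDerivAt_snd), by simp⟩
  rw [flipMap, surjective_fderiv_suspendedMap_iff hg, hval]
  refine not_congr (and_congr ⟨fun h => ?_, fun h => ?_⟩ Iff.rfl) <;> linarith

/-- **The critical curve of the flipping family**, `u ↦ (2 s u - 4 u³, u, 0, 0)`. [folklore] -/
def flipCurve (s u : ℝ) : 𝔼 4 :=
  (2 * s * u - 4 * u ^ 3) • EuclideanSpace.single (0 : Fin 4) (1 : ℝ) +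
    u • EuclideanSpace.single (1 : Fin 4) (1 : ℝ)

/-- **The critical set of the flipping family is exactly its critical curve** (for every
parameter `s`): `d(F_s)_x` is not onto iff `x = flipCurve s u` for some `u` (namely `u = x₁`).
[folklore] -/
theorem not_surjective_fderiv_flipMap_iff_exists (s : ℝ) (x : 𝔼 4) :
    ¬ Surjective (fderiv ℝ (flipMap s) x) ↔ ∃ u, x = flipCurve s u := by
  rw [surjective_fderiv_flipMap_iff, not_not]
  constructor
  · rintro ⟨h0, h2, h3⟩
    refine ⟨x 1, ?_⟩
    ext i
    fin_cases i
    · simpa [flipCurve] using h0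
    · simp [flipCurve]
    · simpa [flipCurve] using h2
    · simpa [flipCurve] using h3
  · rintro ⟨u, rfl⟩
    simp [flipCurve]

/-- The critical curve of the flipping family is injective (parametrised by `x`), so the
critical set is a connected embedded arc for every `s`. [folklore] -/
theorem injective_flipCurve (s : ℝ) : Injective (flipCurve s) := fun u u' h => by
  simpa [flipCurve] using congrArg (fun x : 𝔼 4 => x 1) h

end Literature.Topology.FourManifolds

end
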